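import Literature.MathematicalPhysics.QuantumLattice.HeisenbergCorrelationGramWindows
import Literature.MathematicalPhysics.QuantumLattice.HeisenbergTorusReflection
import HarnessLib

/-!
# Site-monotonicity of the ground-state two-point function from reflection positivity (Lees–Taggi 2021, Theorem 4)

Topic `MathematicalPhysics/QuantumLattice`; companion of `HeisenbergCorrelationGramWindows.lean`
(the reflection-positivity Gram window `heis_rpGramWindow_range` of Dyson–Lieb–Simon Thm 4.2 /
Kennedy–Lieb–Shastry eq. (25)) and `HeisenbergTorusReflection.lean` (axis reflection
`heisRedCorr2_reflect_mod`). Same vocabulary: `c(a, b) = heisRedCorr2 L n a b = Re ω₀(Sᶻ_0 Sᶻ_(a,b))`,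
the translation-reduced two-point function of the tracial ground state of the spin-`n/2` Heisenberg
antiferromagnet on the square torus `(ℤ/Lℤ)²`, `L = 2k` even.

B. Lees, L. Taggi, *Site-monotonicity properties for reflection positive measures with applications
to quantum spin systems*, J. Stat. Phys. **183** (2021) 38, arXiv:2002.12666 [LeesTaggi2021]; held
text read 2026-08-23 (arXiv edition; Theorem 1 and Lemma 7 with its two- and four-point sets `Q`,
§3.1 Theorem 4).

**What is printed (§3.1, Theorem 4).** For the quantum Heisenberg models
`H_u = -2 Σ_{xy} (S¹_x S¹_y + u S²_x S²_y + S³_x S³_y)` with `u ≤ 0` ("`u = -1` is equivalent to the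
Heisenberg antiferromagnet"), any spin `S`, `β ≥ 0`, `d ≥ 2` and `L` even, reflection positivity for
reflections through EDGES gives, for every `z ≠ 0` and every axis `i`:
`⟨S³_o S³_z⟩ ≤ ⟨S³_o S³_{(z·eᵢ)eᵢ}⟩` if `z·eᵢ` is odd;
`⟨S³_o S³_z⟩ ≤ ½(⟨S³_o S³_{(z·eᵢ+1)eᵢ}⟩ + ⟨S³_o S³_{(z·eᵢ-1)eᵢ}⟩)` if `z·eᵢ ≠ 0` is even; and for
`y ⊥ eᵢ` the function `n ↦ ⟨S³_o S³_{y+neᵢ}⟩ + ⟨S³_o S³_{neᵢ}⟩` is non-increasing for odd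
`n ∈ (0, L/2)`.  In the antiferromagnetic frame used by the tree (no sublattice rotation) the
`H_{-1}` two-point function at `z = (a, b)` is the staggered correlation
`G(a, b) = (-1)^{a+b} c(a, b)`; at `T = 0` (the tree's tracial ground state, the `β → ∞` case of the
printed Gibbs state) and `d = 2` the three statements read, for the torus of side `2k`:

* `leesTaggi_axisDomination_odd`: `(-1)^{(2i+1)+b} c(2i+1, b) ≤ -c(2i+1, 0)` (`i < k`, any `b`);
* `leesTaggi_axisAverage_even`: `(-1)^{(2i+2)+b} c(2i+2, b) ≤ ½(-c(2i+1, 0) - c(2i+3, 0))`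
  (`i + 1 < k`, any `b`);
* `leesTaggi_oddAxis_antitone`: for odd `a` with `a + 1 ≤ k` and any `b`,
  `-c(a+2, 0) - (-1)^b c(a+2, b) ≤ -c(a, 0) - (-1)^b c(a, b)`.

They are proved here exactly as in the paper: Lemma 7 of [LeesTaggi2021] is the Schwarz inequality
of reflection positivity at a two-point (resp. four-point) set `Q`, i.e. a principal `2 × 2`
(resp. `4 × 4`) compression of the Gram form `[-c(i + i' + 1, |t - t'|)] ⪰ 0`
(`heis_rpGramWindow_range`, [cite: DLS1978, Theorem 4.2] [cite: KLS1988JSP, eq. (25)]), and the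
monotonicity is "midpoint-convex along the odd axis sites + symmetric under the torus reflection
`a ↦ 2k - a` ⇒ non-increasing up to the middle" (the paper's contradiction chain, proof of Thm 1,
§4). On the way the slightly sharper two-sided forms that the same Schwarz inequality gives are
recorded (`heisRedCorr2_two_mul_abs_le_axis`: `2|c(i+i'+1, b)| ≤ -c(2i+1,0) - c(2i'+1,0)`;
monotonicity for both signs `ε = ±1` of the transverse term), together with the versions along the
second axis (`heisRedCorr2_swap`). Everything holds for every spin `n/2` and every even side.
PROVED; no named facts, no numerical input. (The geometric-mean sharpening of the even-site bound and
the explicit odd-axis margins of the cell record `pub-hubbard` live under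
`Summits/HubbardSuperconductivity/HubbardLadder/NeelSignOddAxisGeometric.lean`; they are not
re-proved here.)

## References

* [LeesTaggi2021] B. Lees, L. Taggi, J. Stat. Phys. 183 (2021) 38, Thm 1, Lemma 7, §3.1 Thm 4.
* [DLS1978] F. J. Dyson, E. H. Lieb, B. Simon, J. Stat. Phys. 18 (1978) 335, Theorem 4.2.
* [KLS1988JSP] T. Kennedy, E. H. Lieb, B. S. Shastry, J. Stat. Phys. 53 (1988) 1019, eq. (25).
-/

noncomputable section

open Finset

namespace Literature.MathematicalPhysics.QuantumLattice

/-! ### Compression of the reflection-positivity window to finitely many weighted sites -/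

/-- A table supported on finitely many window sites `s j = (row, offset)` with weights `c j`,
integrated against `F` over a window containing the sites, is the weighted sum of the values of `F`
(coincident sites aggregate). [folklore] -/
private theorem sum_window_comb (m w : ℕ) {r : ℕ} (s : Fin r → ℕ × ℕ)
    (hs : ∀ j, (s j).1 < m ∧ (s j).2 < w) (c : Fin r → ℝ) (F : ℕ → ℕ → ℝ) :
    ∑ i ∈ range m, ∑ t ∈ range w, (∑ j, if (i, t) = s j then c j else 0) * F i t =
      ∑ j, c j * F (s j).1 (s j).2 := by
  have h1 : ∀ i t, (∑ j, if (i, t) = s j then c j else 0) * F i t =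
      ∑ j, (if (i, t) = s j then c j * F i t else 0) := by
    intro i t
    rw [sum_mul]
    refine sum_congr rfl fun j _ => ?_
    split_ifs <;> simp
  simp_rw [h1]
  have h2 : ∀ i, ∑ t ∈ range w, ∑ j, (if (i, t) = s j then c j * F i t else 0) =
      ∑ j, ∑ t ∈ range w, (if (i, t) = s j then c j * F i t else 0) := fun i => sum_comm
  simp_rw [h2]
  rw [sum_comm]
  refine sum_congr rfl fun j _ => ?_
  rw [sum_eq_single_of_mem (s j).1 (mem_range.2 (hs j).1)]
  · rw [sum_eq_single_of_mem (s j).2 (mem_range.2 (hs j).2)]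
    · simp
    · intro t _ ht
      rw [if_neg]
      intro h
      exact ht (by simpa using congrArg Prod.snd h)
  · intro i _ hi
    refine sum_eq_zero fun t _ => ?_
    rw [if_neg]
    intro h
    exact hi (by simpa using congrArg Prod.fst h)

/-- **Reflection positivity at finitely many weighted sites** (the Schwarz inequality of
[LeesTaggi2021, Lemma 7] in Gram form): on the torus of side `2k`, for sites `s j = (i_j, t_j)` with
rows `i_j < k` next to the reflection plane and arbitrary transverse offsets `t_j`, and real weights
`c j`, `0 ≤ Σ_{j,j'} c_j c_{j'} (−c(i_j + i_{j'} + 1, |t_j − t_{j'}|))`.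
[cite: LeesTaggi2021, Lemma 7] [cite: DLS1978, Theorem 4.2] [cite: KLS1988JSP, eq. (25)] -/
theorem heis_rpGram_sites (k n : ℕ) [NeZero (2 * k)] {r : ℕ} (s : Fin r → ℕ × ℕ)
    (hs : ∀ j, (s j).1 < k) (c : Fin r → ℝ) :
    0 ≤ ∑ j, ∑ j', c j * c j' *
      -heisRedCorr2 (2 * k) n ((s j).1 + (s j').1 + 1) (Int.natAbs (((s j).2 : ℤ) - (s j').2)) := by
  -- a transverse window wide enough for all the sites
  set w : ℕ := (Finset.univ.sup fun j => (s j).2) + 1 with hw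
  have hsw : ∀ j, (s j).1 < k ∧ (s j).2 < w := fun j =>
    ⟨hs j, Nat.lt_succ_of_le (Finset.le_sup (f := fun j => (s j).2) (mem_univ j))⟩
  let v : ℕ → ℕ → ℝ := fun i t => ∑ j, if (i, t) = s j then c j else 0
  have h := heis_rpGramWindow_range k n k w le_rfl v
  -- compress the inner double sum, then the outer one
  have inner : ∀ i t, ∑ i' ∈ range k, ∑ t' ∈ range w,
      v i t * v i' t' * -heisRedCorr2 (2 * k) n (i + i' + 1) (Int.natAbs ((t : ℤ) - t')) =
      v i t * ∑ j', c j' * -heisRedCorr2 (2 * k) n (i + (s j').1 + 1)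
        (Int.natAbs ((t : ℤ) - (s j').2)) := by
    intro i t
    rw [← sum_window_comb k w s hsw c (fun i' t' => -heisRedCorr2 (2 * k) n (i + i' + 1)
      (Int.natAbs ((t : ℤ) - t'))), mul_sum]
    refine sum_congr rfl fun i' _ => ?_
    rw [mul_sum]
    refine sum_congr rfl fun t' _ => ?_
    ring
  simp_rw [inner] at h
  rw [sum_window_comb k w s hsw c (fun i t => ∑ j', c j' * -heisRedCorr2 (2 * k) n
    (i + (s j').1 + 1) (Int.natAbs ((t : ℤ) - (s j').2)))] at h
  refine h.trans_eq (sum_congr rfl fun j _ => ?_)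
  rw [mul_sum]
  exact sum_congr rfl fun j' _ => by ring

/-! ### The two-site Schwarz inequality (the set `Q = {o, z}` of the paper) -/

/-- **Two-site reflection-positivity minor with a transverse offset**: on the torus of side `2k`,
for rows `i, i' < k`, any transverse offset `b` and reals `α, β`,
`0 ≤ α²(−c(2i+1, 0)) + 2αβ(−c(i+i'+1, b)) + β²(−c(2i'+1, 0))`.
[cite: LeesTaggi2021, Lemma 7] [cite: DLS1978, Theorem 4.2] [cite: KLS1988JSP, eq. (25)] -/
theorem heis_rpTwoSiteMinor (k n : ℕ) [NeZero (2 * k)] {i i' : ℕ} (hi : i < k) (hi' : i' < k)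
    (b : ℕ) (α β : ℝ) :
    0 ≤ α ^ 2 * -heisRedCorr2 (2 * k) n (2 * i + 1) 0 +
      2 * α * β * -heisRedCorr2 (2 * k) n (i + i' + 1) b +
        β ^ 2 * -heisRedCorr2 (2 * k) n (2 * i' + 1) 0 := by
  have h := heis_rpGram_sites k n ![(i, 0), (i', b)]
    (fun j => by fin_cases j <;> simpa) ![α, β]
  simp only [Fin.sum_univ_two, Matrix.cons_val_zero, Matrix.cons_val_one] at h
  have e1 : i + i + 1 = 2 * i + 1 := by ring
  have e2 : i' + i' + 1 = 2 * i' + 1 := by ring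
  have e3 : i' + i + 1 = i + i' + 1 := by ring
  have n1 : Int.natAbs (((0 : ℕ) : ℤ) - ((0 : ℕ) : ℤ)) = 0 := by simp
  have n2 : Int.natAbs (((0 : ℕ) : ℤ) - (b : ℤ)) = b := by simp
  have n3 : Int.natAbs ((b : ℤ) - ((0 : ℕ) : ℤ)) = b := by simp
  have n4 : Int.natAbs ((b : ℤ) - (b : ℤ)) = 0 := by simp
  rw [n1, n2, n3, n4, e1, e2, e3] at h
  nlinarith [h]

/-- **Two-sided form of the two-site inequality**: `2|c(i+i'+1, b)| ≤ −c(2i+1, 0) − c(2i'+1, 0)`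
for rows `i, i' < k` of the torus of side `2k` and every transverse offset `b` (test weights
`(1, 1)` and `(1, −1)`). [cite: LeesTaggi2021, Thm 4 (Thm 1, Lemma 7)] [cite: KLS1988JSP, eq. (25)] -/
theorem heisRedCorr2_two_mul_abs_le_axis (k n : ℕ) [NeZero (2 * k)] {i i' : ℕ} (hi : i < k)
    (hi' : i' < k) (b : ℕ) :
    2 * |heisRedCorr2 (2 * k) n (i + i' + 1) b| ≤
      -heisRedCorr2 (2 * k) n (2 * i + 1) 0 - heisRedCorr2 (2 * k) n (2 * i' + 1) 0 := by
  have h₁ := heis_rpTwoSiteMinor k n hi hi' b 1 1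
  have h₂ := heis_rpTwoSiteMinor k n hi hi' b 1 (-1)
  rcases abs_cases (heisRedCorr2 (2 * k) n (i + i' + 1) b) with ⟨habs, _⟩ | ⟨habs, _⟩ <;>
    rw [habs] <;> nlinarith [h₁, h₂]

/-! ### Lees–Taggi Theorem 4, first display: axis domination -/

/-- **[LeesTaggi2021, Thm 4], odd coordinate** (ground state, `d = 2`, every spin `n/2`, torus of
side `2k`): for `z = (2i+1, b)` with `i < k`, `G(o, z) ≤ G(o, (2i+1)e₁)`, i.e. in the tree's
unrotated antiferromagnetic correlation `c = Re ω₀(Sᶻ_0 Sᶻ_z)` (staggered sign `G = (-1)^{a+b} c`):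
`(-1)^{(2i+1)+b} c(2i+1, b) ≤ -c(2i+1, 0)`. [cite: LeesTaggi2021, Thm 4] -/
theorem leesTaggi_axisDomination_odd (k n : ℕ) [NeZero (2 * k)] {i : ℕ} (hi : i < k) (b : ℕ) :
    (-1 : ℝ) ^ (2 * i + 1 + b) * heisRedCorr2 (2 * k) n (2 * i + 1) b ≤
      -heisRedCorr2 (2 * k) n (2 * i + 1) 0 := by
  have h := heisRedCorr2_two_mul_abs_le_axis k n hi hi b
  have e : i + i + 1 = 2 * i + 1 := by ring
  rw [e] at h
  have habs : (-1 : ℝ) ^ (2 * i + 1 + b) * heisRedCorr2 (2 * k) n (2 * i + 1) b ≤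
      |heisRedCorr2 (2 * k) n (2 * i + 1) b| := by
    refine le_trans (le_abs_self _) (le_of_eq ?_)
    rw [abs_mul, abs_pow, abs_neg, abs_one, one_pow, one_mul]
  linarith

/-- The two-sided form of the odd-coordinate axis domination: `|c(2i+1, b)| ≤ -c(2i+1, 0)`
(`i < k`, any `b`). [cite: LeesTaggi2021, Thm 4] [cite: KLS1988JSP, eq. (25)] -/
theorem heisRedCorr2_abs_le_axis_odd (k n : ℕ) [NeZero (2 * k)] {i : ℕ} (hi : i < k) (b : ℕ) :
    |heisRedCorr2 (2 * k) n (2 * i + 1) b| ≤ -heisRedCorr2 (2 * k) n (2 * i + 1) 0 := by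
  have h := heisRedCorr2_two_mul_abs_le_axis k n hi hi b
  have e : i + i + 1 = 2 * i + 1 := by ring
  rw [e] at h
  linarith

/-- **[LeesTaggi2021, Thm 4], even coordinate** (ground state, `d = 2`, every spin, torus of side
`2k`): for `z = (2i+2, b)` with `i + 1 < k`,
`G(o, z) ≤ ½ (G(o, (2i+1)e₁) + G(o, (2i+3)e₁))` — the ARITHMETIC-mean bound as printed:
`(-1)^{(2i+2)+b} c(2i+2, b) ≤ ½(-c(2i+1, 0) - c(2i+3, 0))`. [cite: LeesTaggi2021, Thm 4] -/
theorem leesTaggi_axisAverage_even (k n : ℕ) [NeZero (2 * k)] {i : ℕ} (hi : i + 1 < k) (b : ℕ) :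
    (-1 : ℝ) ^ (2 * i + 2 + b) * heisRedCorr2 (2 * k) n (2 * i + 2) b ≤
      (-heisRedCorr2 (2 * k) n (2 * i + 1) 0 - heisRedCorr2 (2 * k) n (2 * i + 3) 0) / 2 := by
  have h := heisRedCorr2_two_mul_abs_le_axis k n (i := i) (i' := i + 1) (by omega) hi b
  have e1 : i + (i + 1) + 1 = 2 * i + 2 := by ring
  have e2 : 2 * (i + 1) + 1 = 2 * i + 3 := by ring
  rw [e1, e2] at h
  have habs : (-1 : ℝ) ^ (2 * i + 2 + b) * heisRedCorr2 (2 * k) n (2 * i + 2) b ≤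
      |heisRedCorr2 (2 * k) n (2 * i + 2) b| := by
    refine le_trans (le_abs_self _) (le_of_eq ?_)
    rw [abs_mul, abs_pow, abs_neg, abs_one, one_pow, one_mul]
  linarith

/-- The two-sided form of the even-coordinate bound: `|c(2i+2, b)| ≤ ½(-c(2i+1, 0) - c(2i+3, 0))`
(`i + 1 < k`, any `b`). [cite: LeesTaggi2021, Thm 4] [cite: KLS1988JSP, eq. (25)] -/
theorem heisRedCorr2_abs_le_axis_even (k n : ℕ) [NeZero (2 * k)] {i : ℕ} (hi : i + 1 < k) (b : ℕ) :
    |heisRedCorr2 (2 * k) n (2 * i + 2) b| ≤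
      (-heisRedCorr2 (2 * k) n (2 * i + 1) 0 - heisRedCorr2 (2 * k) n (2 * i + 3) 0) / 2 := by
  have h := heisRedCorr2_two_mul_abs_le_axis k n (i := i) (i' := i + 1) (by omega) hi b
  have e1 : i + (i + 1) + 1 = 2 * i + 2 := by ring
  have e2 : 2 * (i + 1) + 1 = 2 * i + 3 := by ring
  rw [e1, e2] at h
  linarith

/-- Axis domination along the SECOND axis (torus symmetry `c(a, b) = c(b, a)`): for `i < k` and any
`a`, `|c(a, 2i+1)| ≤ -c(0, 2i+1)`. [cite: LeesTaggi2021, Thm 4] [cite: KLS1988JSP, eq. (25)] -/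
theorem heisRedCorr2_abs_le_axis_odd_snd (k n : ℕ) [NeZero (2 * k)] {i : ℕ} (hi : i < k) (a : ℕ) :
    |heisRedCorr2 (2 * k) n a (2 * i + 1)| ≤ -heisRedCorr2 (2 * k) n 0 (2 * i + 1) := by
  rw [heisRedCorr2_swap (2 * k) n a, heisRedCorr2_swap (2 * k) n 0]
  exact heisRedCorr2_abs_le_axis_odd k n hi a

/-- The even-coordinate bound along the SECOND axis: for `i + 1 < k` and any `a`,
`|c(a, 2i+2)| ≤ ½(-c(0, 2i+1) - c(0, 2i+3))`. [cite: LeesTaggi2021, Thm 4] [cite: KLS1988JSP, eq. (25)] -/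
theorem heisRedCorr2_abs_le_axis_even_snd (k n : ℕ) [NeZero (2 * k)] {i : ℕ} (hi : i + 1 < k)
    (a : ℕ) :
    |heisRedCorr2 (2 * k) n a (2 * i + 2)| ≤
      (-heisRedCorr2 (2 * k) n 0 (2 * i + 1) - heisRedCorr2 (2 * k) n 0 (2 * i + 3)) / 2 := by
  rw [heisRedCorr2_swap (2 * k) n a, heisRedCorr2_swap (2 * k) n 0 (2 * i + 1),
    heisRedCorr2_swap (2 * k) n 0 (2 * i + 3)]
  exact heisRedCorr2_abs_le_axis_even k n hi a

/-! ### Lees–Taggi Theorem 4, second display: monotonicity along the odd axis sites -/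

/-- **Midpoint convexity along the odd axis sites** (the four-point set
`Q = {o, z, z₁e₁, z - z₁e₁}` of [LeesTaggi2021, proof of Thm 1]): on the torus of side `2k`, for
`i + 2 < k`, any transverse offset `b` and either sign `ε = ±1`, the combination
`Φ(a) := -c(a, 0) - ε c(a, b)` satisfies `2 Φ(2i+3) ≤ Φ(2i+1) + Φ(2i+5)` — the Gram form at the
test table `δ_{(i,0)} + ε δ_{(i,b)} - δ_{(i+2,0)} - ε δ_{(i+2,b)}`.
[cite: LeesTaggi2021, Thm 4 (proof of Thm 1, §4)] [cite: KLS1988JSP, eq. (25)] -/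
theorem heisRedCorr2_oddAxis_midpointConvex (k n : ℕ) [NeZero (2 * k)] {i : ℕ} (hi : i + 2 < k)
    (b : ℕ) {ε : ℝ} (hε : ε = 1 ∨ ε = -1) :
    2 * (-heisRedCorr2 (2 * k) n (2 * i + 3) 0 - ε * heisRedCorr2 (2 * k) n (2 * i + 3) b) ≤
      (-heisRedCorr2 (2 * k) n (2 * i + 1) 0 - ε * heisRedCorr2 (2 * k) n (2 * i + 1) b) +
        (-heisRedCorr2 (2 * k) n (2 * i + 5) 0 - ε * heisRedCorr2 (2 * k) n (2 * i + 5) b) := by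
  have h := heis_rpGram_sites k n ![(i, 0), (i, b), (i + 2, 0), (i + 2, b)]
    (fun j => by fin_cases j <;> simp <;> omega) ![1, ε, -1, -ε]
  simp only [Fin.sum_univ_four, Matrix.cons_val_zero, Matrix.cons_val_one, Matrix.head_cons,
    Matrix.cons_val_two, Matrix.cons_val_three, Matrix.tail_cons] at h
  have e1 : i + i + 1 = 2 * i + 1 := by ring
  have e2 : i + (i + 2) + 1 = 2 * i + 3 := by ring
  have e3 : i + 2 + i + 1 = 2 * i + 3 := by ring
  have e4 : i + 2 + (i + 2) + 1 = 2 * i + 5 := by ring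
  have n1 : Int.natAbs (((0 : ℕ) : ℤ) - ((0 : ℕ) : ℤ)) = 0 := by simp
  have n2 : Int.natAbs (((0 : ℕ) : ℤ) - (b : ℤ)) = b := by simp
  have n3 : Int.natAbs ((b : ℤ) - ((0 : ℕ) : ℤ)) = b := by simp
  have n4 : Int.natAbs ((b : ℤ) - (b : ℤ)) = 0 := by simp
  simp only [n1, n2, n3, n4, e1, e2, e3, e4] at h
  rcases hε with rfl | rfl <;> norm_num at h ⊢ <;> linarith

/-- From midpoint convexity and a reflection symmetry to monotonicity: a real sequence `f` on
`0, …, J` with non-decreasing increments and `f J = f 0`, `J ≥ 1`, has `f 1 ≤ f 0`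
(the contradiction chain of [LeesTaggi2021, proof of Thm 1, §4]). [folklore] -/
private theorem step_le_of_convex_of_symm (f : ℕ → ℝ) {J : ℕ} (hJ : 1 ≤ J)
    (hconv : ∀ j, j + 2 ≤ J → f (j + 1) - f j ≤ f (j + 2) - f (j + 1)) (hsym : f J = f 0) :
    f 1 ≤ f 0 := by
  by_contra hlt'
  have hlt : f 0 < f 1 := not_le.mp hlt'
  -- every increment is at least the first one
  have hmono : ∀ j, j + 1 ≤ J → f 1 - f 0 ≤ f (j + 1) - f j := by
    intro j
    induction j with
    | zero => intro _; exact le_rfl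
    | succ j ih =>
      intro hj
      have h1 := ih (by omega)
      have h2 := hconv j (by omega)
      linarith
  have hsum : (J : ℝ) * (f 1 - f 0) ≤ ∑ j ∈ range J, (f (j + 1) - f j) :=
    calc (J : ℝ) * (f 1 - f 0) = ∑ j ∈ range J, (f 1 - f 0) := by
          rw [sum_const, card_range, nsmul_eq_mul]
      _ ≤ ∑ j ∈ range J, (f (j + 1) - f j) :=
          sum_le_sum fun j hj => hmono j (by have := mem_range.1 hj; omega)
  rw [sum_range_sub, hsym, sub_self] at hsum
  have hJ' : (1 : ℝ) ≤ J := by exact_mod_cast hJ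
  nlinarith

/-- The torus reflection `a ↦ 2k - a` of the first axis: `c(2k - a, b) = c(a, b)` for `0 < a < 2k`.
[cite: KLS1988JSP, p. 1021] [cite: DLS1978, §4] -/
theorem heisRedCorr2_two_mul_sub (k n : ℕ) [NeZero (2 * k)] {a : ℕ} (ha0 : 0 < a) (ha : a < 2 * k)
    (b : ℕ) : heisRedCorr2 (2 * k) n (2 * k - a) b = heisRedCorr2 (2 * k) n a b := by
  rw [heisRedCorr2_reflect_mod (2 * k) n a b, Nat.mod_eq_of_lt ha,
    Nat.mod_eq_of_lt (by omega : 2 * k - a < 2 * k)]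

/-- **[LeesTaggi2021, Thm 4], monotonicity along the odd axis sites** (ground state, `d = 2`,
every spin, torus of side `2k`), in the general-sign form: for odd `a` with `a + 1 ≤ k`, any
transverse offset `b` and either sign `ε = ±1`,
`-c(a+2, 0) - ε c(a+2, b) ≤ -c(a, 0) - ε c(a, b)`
— convex along the odd sites (`heisRedCorr2_oddAxis_midpointConvex`) and symmetric under
`a ↦ 2k - a` (`heisRedCorr2_two_mul_sub`), hence non-increasing up to the middle.
[cite: LeesTaggi2021, Thm 4] [cite: KLS1988JSP, eq. (25)] -/
theorem heisRedCorr2_oddAxis_antitone (k n : ℕ) [NeZero (2 * k)] {a : ℕ} (ha : Odd a)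
    (hak : a + 1 ≤ k) (b : ℕ) {ε : ℝ} (hε : ε = 1 ∨ ε = -1) :
    -heisRedCorr2 (2 * k) n (a + 2) 0 - ε * heisRedCorr2 (2 * k) n (a + 2) b ≤
      -heisRedCorr2 (2 * k) n a 0 - ε * heisRedCorr2 (2 * k) n a b := by
  obtain ⟨i₀, rfl⟩ := ha
  -- the sequence `j ↦ Φ(a + 2j)` on `0, …, J` with `a + 2J = 2k - a`
  set f : ℕ → ℝ := fun j => -heisRedCorr2 (2 * k) n (2 * i₀ + 1 + 2 * j) 0 -
    ε * heisRedCorr2 (2 * k) n (2 * i₀ + 1 + 2 * j) b with hf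
  have hJ : 1 ≤ k - (2 * i₀ + 1) := by omega
  have hconv : ∀ j, j + 2 ≤ k - (2 * i₀ + 1) → f (j + 1) - f j ≤ f (j + 2) - f (j + 1) := by
    intro j hj
    have hc := heisRedCorr2_oddAxis_midpointConvex k n (i := i₀ + j) (by omega) b hε
    have e1 : 2 * (i₀ + j) + 1 = 2 * i₀ + 1 + 2 * j := by ring
    have e2 : 2 * (i₀ + j) + 3 = 2 * i₀ + 1 + 2 * (j + 1) := by ring
    have e3 : 2 * (i₀ + j) + 5 = 2 * i₀ + 1 + 2 * (j + 2) := by ring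
    rw [e1, e2, e3] at hc
    simp only [hf]
    linarith
  have hsym : f (k - (2 * i₀ + 1)) = f 0 := by
    simp only [hf, Nat.mul_zero, Nat.add_zero]
    have e : 2 * i₀ + 1 + 2 * (k - (2 * i₀ + 1)) = 2 * k - (2 * i₀ + 1) := by omega
    rw [e, heisRedCorr2_two_mul_sub k n (by omega) (by omega) 0,
      heisRedCorr2_two_mul_sub k n (by omega) (by omega) b]
  have h := step_le_of_convex_of_symm f hJ hconv hsym
  have e1 : 2 * i₀ + 1 + 2 * 1 = 2 * i₀ + 1 + 2 := by ring
  simp only [hf, Nat.mul_zero, Nat.add_zero, e1] at h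
  exact h

/-- **[LeesTaggi2021, Thm 4], second display, as printed** (ground state, `d = 2`, every spin,
torus of side `L = 2k`): for `y = (0, b) ⊥ e₁` the function
`n ↦ G(o, y + n e₁) + G(o, n e₁)`, `G(a, b) = (-1)^{a+b} c(a, b)`, is non-increasing along the odd
`n` with `n + 1 ≤ k` (`n, n + 2` are consecutive odd sites in `(0, L/2]`):
`G(n+2, b) + G(n+2, 0) ≤ G(n, b) + G(n, 0)`. [cite: LeesTaggi2021, Thm 4] -/
theorem leesTaggi_oddAxis_antitone (k n : ℕ) [NeZero (2 * k)] {a : ℕ} (ha : Odd a)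
    (hak : a + 1 ≤ k) (b : ℕ) :
    (-1 : ℝ) ^ (a + 2 + b) * heisRedCorr2 (2 * k) n (a + 2) b +
        (-1 : ℝ) ^ (a + 2) * heisRedCorr2 (2 * k) n (a + 2) 0 ≤
      (-1 : ℝ) ^ (a + b) * heisRedCorr2 (2 * k) n a b + (-1 : ℝ) ^ a * heisRedCorr2 (2 * k) n a 0 := by
  have hε : ((-1 : ℝ) ^ b = 1 ∨ (-1 : ℝ) ^ b = -1) := by
    rcases Nat.even_or_odd b with hb | hb
    · exact Or.inl hb.neg_one_pow
    · exact Or.inr hb.neg_one_pow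
  have h := heisRedCorr2_oddAxis_antitone k n ha hak b hε
  have ha2 : Odd (a + 2) := by obtain ⟨i, rfl⟩ := ha; exact ⟨i + 1, by ring⟩
  rw [pow_add, pow_add (-1 : ℝ) a b, ha.neg_one_pow, ha2.neg_one_pow]
  linarith

end Literature.MathematicalPhysics.QuantumLattice

end
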